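import Summits.BirchSwinnertonDyer.Rank1Residual.Additive.DisegniLinePointwise
import Literature.NumberTheory.EllipticCurves.PAdicPowerSeriesInterpolationAgreementCpProofs
import Literature.NumberTheory.EllipticCurves.PAdicLFunctionBranchInterpolationProofs
import HarnessLib

/-!
# STEP B(2) of the kernel derivation of `hFact`: the FIRST COEFFICIENT of Disegni's line function is
# `c · [T¹]L_p(f_V, α, ω^{(p−1)/2}) · L_p(f_{V′}, α, ω^{(p−1)/2})(0)` (uniqueness of bounded interpolants;
# cell `bsd-addord`, seat `bsd-addord-gz` gen 4)

HONEST FRAMING (cell `bsd-addord`; PARTITION (D-0054): EXCLUDED-DOMAIN additive rows §E, B6 = O7-ord r1 ×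
every consumer of hFact — types-the-object-of; booked 0). THEOREMS ONLY. From STEP B(1)
(`hasLineValueAt_twin_of_cycLineInterpolation`: Disegni's `G` equals `c · v_f · v_{f′}` at the twin point
of every typed complex character), the twin dictionary (`exists_eq_twin_of_isOfFinOrder` &c., p409058: every
`ℂ_p`-valued character of `Γ` is a twin), the tree's Mazur–Tate–Teitelbaum interpolation THEOREM
(`hasSum_coeff_padicLFunctionBranch_mul_pow_of_isNewformOf`: `v_g` IS the value of the branch
`L_p(g, α, ω^{(p−1)/2}, T)` at `χ(γ) − 1`) and the bounded-interpolant uniqueness over `ℂ_p`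
(`coeff_one_eq_of_forall_hasSum_of_bounded`, p408899), we get, when the branch of `f = f_V` vanishes at
`T = 0` (analytic rank one): `[T¹]G = c · ι([T¹]B_f) · ι(B_{f′}(0))`, `c = ι⁻¹(u·Car·Ω⁺_f·Ω⁺_{f′})`.
Displayed inputs as in STEP B(1): `hArt` (lit p408789), the two coefficient relations, `CycLineInterpolation`.

What is NOT here: the height side (STEP C: PAdicRatioClause/ArchRatioClause ⟹ `TwistedBranchGrossZagierAt`).

References: [Disegni2017] Thm. A, Lemma 10.2.1; [MazurTateTeitelbaum1986Invent] §I.11–I.14; cell sheet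
`run/shared/lean/pub/bsd-addord/lit/HFACT-KERNEL-INPUTS.md` §5.
-/

set_option autoImplicit false

noncomputable section

open scoped Classical MatrixGroups ModularForm NumberField

open CongruenceSubgroup WeierstrassCurve Literature.NumberTheory.EllipticCurves
  Literature.NumberTheory.EllipticCurves.ModularForms
  Literature.NumberTheory.EllipticCurves.Disegni2017

namespace Summit.BirchSwinnertonDyer.Rank1Residual.Additive

section LeadingCoeff

variable {p : ℕ} [hp : Fact p.Prime] (ι : PadicAlgCl p ≃+* ℂ)
  (K : Type) [Field K] [NumberField K] [IsGalois ℚ K]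

/-- Curves with the same `a_p` have the same unit root. [cite: MazurTateTeitelbaum1986Invent, §I.11] -/
theorem unitRoot_eq_of_frobeniusTrace_eq {V V' : WeierstrassCurve ℚ} [V.IsGloballyMinimal]
    [V'.IsGloballyMinimal] (h : V'.frobeniusTrace p = V.frobeniusTrace p) :
    unitRoot V' p = unitRoot V p := by
  unfold unitRoot
  rw [h]

/-- The twin of the trivial character is trivial. [cite: MazurTateTeitelbaum1986Invent, §I.13] -/
theorem twin_one (n : ℕ) :
    ((1 : DirichletCharacter ℂ n)⁻¹.ringHomComp ι.symm.toRingHom).ringHomComp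
        (algebraMap (PadicAlgCl p) ℂ_[p]) = 1 := by
  rw [inv_one, MulChar.ringHomComp_one, MulChar.ringHomComp_one]

/-- **The value `v_g(𝟙)` at level `p` is `α⁻¹ · ∑_{a mod p} (a/p)[a/p]⁺_g = L_p(g, α, ω^{(p−1)/2}, 0)`**
(the tree's `constantCoeff_padicLFunctionBranch_half`, re-indexed from `ZMod (p^1)` to `ZMod p`).
[cite: MazurTateTeitelbaum1986Invent, §I.14 (14.3)] -/
theorem branchValue_one_eq_constantCoeff (hp2 : p ≠ 2) (hm : cyclotomicExponent p ≤ 0 + 1)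
    (V : WeierstrassCurve ℚ) [V.IsElliptic] [V.IsGloballyMinimal] (hord : IsOrdinaryAt V p)
    {N : ℕ} [NeZero N] {g : CuspForm (Gamma0 N) 2} (hg : IsNewformOf V g) :
    algebraMap ℚ_[p] ℂ_[p] ((unitRoot V p : ℚ_[p])⁻¹ ^ (0 + 1)) *
        ∑ b : ZMod (p ^ (0 + 1)),
          (1 : DirichletCharacter ℂ_[p] (p ^ (0 + 1))) b *
            algebraMap ℚ_[p] ℂ_[p] (teichWeight p (p / 2)
              (ZMod.castHom (pow_dvd_pow p hm) (ZMod (p ^ cyclotomicExponent p)) b)) *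
            (ratPlusSymbol g ((b.val : ℚ) / ((p ^ (0 + 1) : ℕ) : ℚ)) : ℂ_[p]) =
      algebraMap ℚ_[p] ℂ_[p]
        (PowerSeries.constantCoeff (padicLFunctionBranch g (unitRoot V p : ℚ_[p]) (p / 2))) := by
  have hpP : p.Prime := hp.out
  rw [constantCoeff_padicLFunctionBranch_half p hp2 V hord hg, map_mul]
  have hα : algebraMap ℚ_[p] ℂ_[p] ((unitRoot V p : ℚ_[p])⁻¹ ^ (0 + 1)) =
      algebraMap ℚ_[p] ℂ_[p] (unitRoot V p : ℚ_[p])⁻¹ := by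
    rw [zero_add, pow_one]
  rw [hα]
  congr 1
  have hp1 : ((p ^ (0 + 1) : ℕ) : ℚ) = (p : ℚ) := by rw [zero_add, pow_one]
  -- each summand: `𝟙(b)·(b/p)·[b/p] = (b/p)·[b/p]` (non-units have `(b/p) = 0`)
  have hsummand : ∀ b : ZMod (p ^ (0 + 1)),
      (1 : DirichletCharacter ℂ_[p] (p ^ (0 + 1))) b *
          algebraMap ℚ_[p] ℂ_[p] (teichWeight p (p / 2)
            (ZMod.castHom (pow_dvd_pow p hm) (ZMod (p ^ cyclotomicExponent p)) b)) *
          (ratPlusSymbol g ((b.val : ℚ) / ((p ^ (0 + 1) : ℕ) : ℚ)) : ℂ_[p]) =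
        algebraMap ℚ_[p] ℂ_[p] (((legendreSym p (b.val : ℤ) : ℚ) *
          ratPlusSymbol g ((b.val : ℚ) / p) : ℚ) : ℚ_[p]) := by
    intro b
    rw [teichWeight_half_castHom p hp2 hm b, hp1]
    by_cases hb : IsUnit b
    · rw [MulChar.one_apply hb, one_mul]
      push_cast
      simp only [map_intCast]
    · have hcop : ¬ Nat.Coprime b.val (p ^ (0 + 1)) := by
        intro h; apply hb
        have hu := (ZMod.isUnit_iff_coprime b.val (p ^ (0 + 1))).mpr h
        rwa [ZMod.natCast_zmod_val] at hu
      have hdvdN : p ∣ b.val := by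
        by_contra hnd
        exact hcop (Nat.Coprime.pow_right _ ((Nat.Prime.coprime_iff_not_dvd hpP).mpr hnd).symm)
      have hz : ((b.val : ℤ) : ZMod p) = 0 :=
        (ZMod.intCast_zmod_eq_zero_iff_dvd _ p).mpr (by exact_mod_cast hdvdN)
      have h0 : legendreSym p (b.val : ℤ) = 0 := (legendreSym.eq_zero_iff p _).mpr hz
      rw [MulChar.map_nonunit _ hb, h0]
      simp
  rw [Finset.sum_congr rfl fun b _ ↦ hsummand b, legendrePlusSymbolSum]
  push_cast
  -- re-index along `ZMod (p^(0+1)) ≃+* ZMod p`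
  have hpe : p ^ (0 + 1) = p := by rw [zero_add, pow_one]
  refine Fintype.sum_equiv (ZMod.ringEquivCongr hpe).toEquiv _ _ fun b ↦ ?_
  rw [RingEquiv.toEquiv_eq_coe, EquivLike.coe_coe, ZMod.ringEquivCongr_val]

/-- **STEP B(2) — the first coefficient of Disegni's line function.** `p ≡ 1 (mod 4)`; `V, V′` globally
minimal, good ordinary at `p` with the same `a_p`, newforms `f, f′`; `f_E` a newform with
`a_n(f_E) = (n/p)a_n(f)`; `a_n(f′) = κ_K(n)a_n(f)`; `G` Disegni's line function for `(f_E, K, α = unitRoot V p)`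
(`CycLineInterpolation`); Artin formalism `hArt`. If the `ω^{(p−1)/2}`-branch of `f` vanishes at `T = 0`,
then `[T¹]G = ι⁻¹(u·Car·Ω⁺_f·Ω⁺_{f′}) · ι([T¹]B_f) · ι(B_{f′}(0))`.
[cite: Disegni2017, Theorem A, Lemma 10.2.1–10.2.2 (arXiv v3 PDF 7–8, 68)]
[cite: MazurTateTeitelbaum1986Invent, §I.11, §I.14 (14.3)] -/
theorem coeff_one_cycLine_eq (hp4 : p % 4 = 1)
    (hArt : rankinSelbergEulerProductHecke_baseChangeDirichlet_eq)
    (h2 : Module.finrank ℚ K = 2) (κ : DirichletCharacter ℂ (NumberField.discr K).natAbs)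
    (hκ : ∀ ℓ : ℕ, ℓ.Prime → ℓ ≠ 2 → κ ℓ = (jacobiSym (NumberField.discr K) ℓ : ℂ))
    (hκ2 : κ 2 = if NumberField.discr K % 8 = 1 then 1
        else if NumberField.discr K % 8 = 5 then -1 else 0)
    (hpd : Nat.Coprime p (NumberField.discr K).natAbs)
    (V V' : WeierstrassCurve ℚ) [V.IsElliptic] [V.IsGloballyMinimal] [V'.IsElliptic] [V'.IsGloballyMinimal]
    (hordV : IsOrdinaryAt V p) (hordV' : IsOrdinaryAt V' p) (hap : V'.frobeniusTrace p = V.frobeniusTrace p)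
    {N NE N' : ℕ} [NeZero N] [NeZero NE] [NeZero N'] {f : CuspForm (Gamma0 N) 2}
    {fE : CuspForm (Gamma0 NE) 2} {f' : CuspForm (Gamma0 N') 2}
    (hfV : IsNewformOf V f) (hfE : IsNewform0 fE) (hfV' : IsNewformOf V' f')
    (hE : ∀ n : ℕ, cuspCoeff fE n = (legendreSym p (n : ℤ) : ℂ) * cuspCoeff f n)
    (hV' : ∀ n : ℕ, cuspCoeff f' n = κ (n : ZMod (NumberField.discr K).natAbs) * cuspCoeff f n)
    {Car : ℝ} {G : PowerSeries ℂ_[p]}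
    (hG : CycLineInterpolation ι K fE (unitRoot V p : ℚ_[p]) Car G)
    (hB0 : PowerSeries.constantCoeff (padicLFunctionBranch f (unitRoot V p : ℚ_[p]) (p / 2)) = 0) :
    PowerSeries.coeff 1 G =
      ((ι.symm ((splitLocalConstant p : ℂ) * (Car : ℂ) * (plusPeriod f : ℂ) * (plusPeriod f' : ℂ)) :
          PadicAlgCl p) : ℂ_[p]) *
        algebraMap ℚ_[p] ℂ_[p]
          (PowerSeries.coeff 1 (padicLFunctionBranch f (unitRoot V p : ℚ_[p]) (p / 2))) *
        algebraMap ℚ_[p] ℂ_[p]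
          (PowerSeries.constantCoeff (padicLFunctionBranch f' (unitRoot V' p : ℚ_[p]) (p / 2))) := by
  have hpP : p.Prime := hp.out
  have hp2 : p ≠ 2 := by intro h; rw [h] at hp4; norm_num at hp4
  have he1 : cyclotomicExponent p = 1 := cyclotomicExponent_eq_one p hp2
  have hα' : unitRoot V' p = unitRoot V p := unitRoot_eq_of_frobeniusTrace_eq hap
  set c : ℂ_[p] := ((ι.symm ((splitLocalConstant p : ℂ) * (Car : ℂ) * (plusPeriod f : ℂ) *
    (plusPeriod f' : ℂ)) : PadicAlgCl p) : ℂ_[p]) with hc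
  set B₁ := padicLFunctionBranch f (unitRoot V p : ℚ_[p]) (p / 2) with hB₁
  set B₂ := padicLFunctionBranch f' (unitRoot V' p : ℚ_[p]) (p / 2) with hB₂
  -- boundedness
  obtain ⟨CG, hCG⟩ := hG.isLineFunction.1
  obtain ⟨C₁, hC₁⟩ := exists_norm_coeff_padicLFunctionBranch_le_of_isNewformOf hordV hfV (p / 2)
  obtain ⟨C₂, hC₂⟩ := exists_norm_coeff_padicLFunctionBranch_le_of_isNewformOf hordV' hfV' (p / 2)
  have hM₁ : MemIwasawaRat p B₁ := memIwasawaRat_of_forall_norm_coeff_le hC₁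
  have hM₂ : MemIwasawaRat p B₂ := memIwasawaRat_of_forall_norm_coeff_le hC₂
  -- the pointwise statement at a twin, for every typed `θ` mod `p^{m+1}`
  have hpt : ∀ (m : ℕ) (hm : cyclotomicExponent p ≤ m + 1) (θ : DirichletCharacter ℂ (p ^ (m + 1))),
      θ.Even → (∃ j : ℕ, orderOf θ = p ^ j) → (θ.IsPrimitive ∨ m = 0) →
      HasLineValueAt G
        (((θ⁻¹.ringHomComp ι.symm.toRingHom).ringHomComp (algebraMap (PadicAlgCl p) ℂ_[p]))
            (cyclotomicGenerator p : ZMod (p ^ (m + 1))) - 1)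
        (c *
          (algebraMap ℚ_[p] ℂ_[p] ((unitRoot V p : ℚ_[p])⁻¹ ^ (m + 1)) *
            ∑ b : ZMod (p ^ (m + 1)),
              ((θ⁻¹.ringHomComp ι.symm.toRingHom).ringHomComp (algebraMap (PadicAlgCl p) ℂ_[p])) b *
                algebraMap ℚ_[p] ℂ_[p] (teichWeight p (p / 2)
                  (ZMod.castHom (pow_dvd_pow p hm) (ZMod (p ^ cyclotomicExponent p)) b)) *
                (ratPlusSymbol f ((b.val : ℚ) / ((p ^ (m + 1) : ℕ) : ℚ)) : ℂ_[p])) *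
          (algebraMap ℚ_[p] ℂ_[p] ((unitRoot V p : ℚ_[p])⁻¹ ^ (m + 1)) *
            ∑ b : ZMod (p ^ (m + 1)),
              ((θ⁻¹.ringHomComp ι.symm.toRingHom).ringHomComp (algebraMap (PadicAlgCl p) ℂ_[p])) b *
                algebraMap ℚ_[p] ℂ_[p] (teichWeight p (p / 2)
                  (ZMod.castHom (pow_dvd_pow p hm) (ZMod (p ^ cyclotomicExponent p)) b)) *
                (ratPlusSymbol f' ((b.val : ℚ) / ((p ^ (m + 1) : ℕ) : ℚ)) : ℂ_[p]))) :=
    fun m hm θ heven hord hprim ↦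
      hasLineValueAt_twin_of_cycLineInterpolation ι K hp4 hArt h2 κ hκ hκ2 hpd hfE hfV.1
        hfV.coeffField_eq_bot hfV'.1 hfV'.coeffField_eq_bot hE hV' hG hm θ heven hord hprim
  -- `T = 0`
  have hm0 : cyclotomicExponent p ≤ 0 + 1 := by rw [he1]
  have h0 : PowerSeries.constantCoeff G =
      c * algebraMap ℚ_[p] ℂ_[p] (PowerSeries.constantCoeff B₁) *
        algebraMap ℚ_[p] ℂ_[p] (PowerSeries.constantCoeff B₂) := by
    have h := hpt 0 hm0 1 (MulChar.one_apply isUnit_one.neg) ⟨0, by rw [orderOf_one, pow_zero]⟩ (Or.inr rfl)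
    rw [twin_one, MulChar.one_apply (isUnit_cyclotomicGenerator_cast p (0 + 1)), sub_self,
      branchValue_one_eq_constantCoeff hp2 hm0 V hordV hfV] at h
    have h' := h
    rw [show (unitRoot V p : ℚ_[p]) = (unitRoot V' p : ℚ_[p]) by rw [hα']] at h'
    -- the second factor re-indexed for `f′` (same `α`)
    have h2' := branchValue_one_eq_constantCoeff hp2 hm0 V' hordV' hfV'
    rw [hα'] at h2'
    rw [h2'] at h
    rw [(h.eq_constantCoeff).symm, hB₁, hB₂, hα', mul_assoc]
  -- the characters of `Γ`
  have hchar : ∀ (m : ℕ) (χ : DirichletCharacter ℂ_[p] (p ^ (m + 2))), χ.IsPrimitive → χ.Even →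
      (∃ j : ℕ, orderOf χ = p ^ j) → ∀ v₁ v₂ : ℂ_[p],
        HasSum (fun i ↦ algebraMap ℚ_[p] ℂ_[p] (PowerSeries.coeff i B₁) *
          (χ (cyclotomicGenerator p : ZMod (p ^ (m + 2))) - 1) ^ i) v₁ →
        HasSum (fun i ↦ algebraMap ℚ_[p] ℂ_[p] (PowerSeries.coeff i B₂) *
          (χ (cyclotomicGenerator p : ZMod (p ^ (m + 2))) - 1) ^ i) v₂ →
        HasSum (fun i ↦ PowerSeries.coeff i G *
          (χ (cyclotomicGenerator p : ZMod (p ^ (m + 2))) - 1) ^ i) (c * v₁ * v₂) := by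
    intro m χ hχ heven hord v₁ v₂ hv₁ hv₂
    have hfin : IsOfFinOrder χ := by
      obtain ⟨j, hj⟩ := hord
      exact orderOf_pos_iff.mp (by rw [hj]; exact pow_pos hpP.pos j)
    obtain ⟨θ, hθ⟩ := exists_eq_twin_of_isOfFinOrder ι χ hfin
    subst hθ
    have hθeven : θ.Even := (twin_even_iff ι θ).mp heven
    have hθprim : θ.IsPrimitive := (twin_isPrimitive_iff ι θ).mp hχ
    have hθord : ∃ j : ℕ, orderOf θ = p ^ j := by rwa [orderOf_twin ι θ] at hord
    have hm : cyclotomicExponent p ≤ (m + 1) + 1 := by rw [he1]; omega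
    -- the MTT values at the twin (tree interpolation theorem), identified with `v₁`, `v₂`
    have hT₁ := hasSum_coeff_padicLFunctionBranch_mul_pow_of_isNewformOf hordV hfV (p / 2) (m := m + 1)
      (by rw [he1]; omega) _ hχ heven hord
    have hT₂ := hasSum_coeff_padicLFunctionBranch_mul_pow_of_isNewformOf hordV' hfV' (p / 2) (m := m + 1)
      (by rw [he1]; omega) _ hχ heven hord
    have e₁ := hv₁.unique hT₁
    have e₂ := hv₂.unique hT₂
    rw [hα'] at e₂
    have h := hpt (m + 1) hm θ hθeven hθord (Or.inl hθprim)
    rw [e₁, e₂]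
    exact h
  have hmain := coeff_one_eq_of_forall_hasSum_of_bounded hCG hM₁ hM₂ c h0 hchar hB0
  rw [hmain, hB₂]

end LeadingCoeff

end Summit.BirchSwinnertonDyer.Rank1Residual.Additive

end
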